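import Mathlib
import Summits.Ventures.PercRepro2.Graph

/-!
# Block substitution: mark-free two-terminal blocks on an arbitrary skeleton — connectivity
between the terminals (blind cell PercRepro2, mine-2 g33)

typer-1 g48's NECKLACE (`CycleNecklaceConn.lean`: `C₅` with each arc replaced by a mark-free
two-terminal block) with the skeleton freed.  A **block substitution** of a skeleton
`ends' : E' → Sym2 V'` into a graph `ends : E → Sym2 V` along a terminal map `q : V' → V` is a
partition of the edges of `G` into blocks `blk e : E'`, block `j` living on a vertex set `Vj j`
which contains the two terminals of `j` (`q k`, `k ∈ ends' j`) and no other terminal, two different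
blocks sharing only terminals (`IsBlockSubst`).  The **pattern** `bsOpen ω j` records whether
block `j` connects its two terminals inside itself (`blockCfg`).

* **`conn_marks_iff_bs`**: `q k ↔ q k'` in `G` under `ω` iff `k ↔ k'` in the skeleton under the
  pattern — the forward direction by the cut argument (`conn_bsOpen_of_conn`: the terminals of the
  skeleton cluster of `k` together with everything reached from them inside their own blocks form
  a set closed under open adjacency, `mem_of_conn_of_closed`), the converse by chaining open blocks
  (`conn_of_conn_bsOpen`).

The law of the pattern and the transport of (HCOV) follow in `BlockSubstLaw.lean`; the
six-terminal and five-terminal corollaries in `SixTerminal.lean`.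
-/

namespace Summit.Ventures.PercRepro2

namespace BlockSubst

section Conn

variable {V : Type*} {E : Type*} {V' : Type*} {E' : Type*}

/-- **A block substitution** of the skeleton `ends'` into the graph `ends` along the terminal map
`q`: the edges of the graph are partitioned into blocks (`blk e`), block `j` lives on the vertex set
`Vj j`, which contains the two terminals `q k`, `k ∈ ends' j`, of the skeleton edge `j`; a vertex of
two different blocks is a terminal of the first; a terminal lies only in the blocks of its own
skeleton edges; the terminals are distinct. -/
structure IsBlockSubst (ends : E → Sym2 V) (ends' : E' → Sym2 V') (q : V' → V) (blk : E → E')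
    (Vj : E' → Set V) : Prop where
  /-- The ends of an edge lie in the vertex set of its block. -/
  ends_mem : ∀ e, ∀ x ∈ ends e, x ∈ Vj (blk e)
  /-- The terminals of block `j` lie in its vertex set. -/
  term_mem : ∀ j, ∀ k ∈ ends' j, q k ∈ Vj j
  /-- A vertex of two different blocks is a terminal of the first. -/
  inter_terms : ∀ j j', j ≠ j' → ∀ x, x ∈ Vj j → x ∈ Vj j' → ∃ k ∈ ends' j, x = q k
  /-- A terminal lies only in the blocks of its own skeleton edges. -/
  term_only : ∀ j k, q k ∈ Vj j → k ∈ ends' j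
  /-- The terminals are distinct. -/
  q_inj : Function.Injective q

/-- The block-`j` configuration: the edges of block `j` that are open in `ω`. -/
def blockCfg [DecidableEq E'] (blk : E → E') (j : E') (ω : Config E) : Config E :=
  fun e => ω e && decide (blk e = j)

variable [DecidableEq E']

/-- The block configuration is below the configuration. -/
lemma blockCfg_le (blk : E → E') (j : E') (ω : Config E) : blockCfg blk j ω ≤ ω := by
  intro e
  simp only [blockCfg]
  cases ω e <;> simp

/-- An open edge of block `j` is open in the block configuration. -/
lemma blockCfg_apply_of_eq {blk : E → E'} {j : E'} {e : E} {ω : Config E} (he : ω e = true)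
    (hj : blk e = j) : blockCfg blk j ω e = true := by
  simp [blockCfg, he, hj]

/-- An edge open in the block configuration is an open edge of the block. -/
lemma of_blockCfg_eq_true {blk : E → E'} {j : E'} {e : E} {ω : Config E}
    (h : blockCfg blk j ω e = true) : ω e = true ∧ blk e = j := by
  simpa [blockCfg] using h

/-- Two configurations agreeing on block `j` have the same block-`j` configuration. -/
lemma blockCfg_congr {blk : E → E'} {j : E'} {ω ω' : Config E}
    (h : ∀ e ∈ {e | blk e = j}, ω e = ω' e) : blockCfg blk j ω = blockCfg blk j ω' := by
  funext e
  simp only [blockCfg]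
  by_cases hj : blk e = j
  · rw [h e hj]
  · simp [hj]

open scoped Classical in
/-- **The block pattern**: block `j` is open iff its two terminals are connected inside it. -/
noncomputable def bsOpen (ends : E → Sym2 V) (ends' : E' → Sym2 V') (q : V' → V) (blk : E → E')
    (ω : Config E) : Config E' :=
  fun j => decide (∀ x y, ends' j = s(x, y) → Conn ends (blockCfg blk j ω) (q x) (q y))

/-- Block `j` is open iff its terminals are connected inside it. -/
lemma bsOpen_eq_true_iff (ends : E → Sym2 V) (ends' : E' → Sym2 V') (q : V' → V) (blk : E → E')
    (ω : Config E) (j : E') :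
    bsOpen ends ends' q blk ω j = true ↔
      ∀ x y, ends' j = s(x, y) → Conn ends (blockCfg blk j ω) (q x) (q y) := by
  simp [bsOpen]

/-- Block `j` is closed iff its terminals are not connected inside it. -/
lemma bsOpen_eq_false_iff (ends : E → Sym2 V) (ends' : E' → Sym2 V') (q : V' → V) (blk : E → E')
    (ω : Config E) (j : E') :
    bsOpen ends ends' q blk ω j = false ↔
      ¬ ∀ x y, ends' j = s(x, y) → Conn ends (blockCfg blk j ω) (q x) (q y) := by
  simp [bsOpen]

variable {ends : E → Sym2 V} {ends' : E' → Sym2 V'} {q : V' → V} {blk : E → E'} {Vj : E' → Set V}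

/-- Inside block `j`, connectivity stays in the vertex set of the block. -/
lemma mem_Vj_of_conn_blockCfg (hB : IsBlockSubst ends ends' q blk Vj) {j : E'} {ω : Config E}
    {x y : V} (hx : x ∈ Vj j) (h : Conn ends (blockCfg blk j ω) x y) : y ∈ Vj j := by
  refine mem_of_conn_of_closed (S := Vj j) ?_ hx h
  intro u _ w huw
  rw [openGraph_adj] at huw
  obtain ⟨_, e, he, hends⟩ := huw
  obtain ⟨_, hj⟩ := of_blockCfg_eq_true he
  have := hB.ends_mem e w (by rw [hends]; exact Sym2.mem_mk_right u w)
  rwa [hj] at this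

/-- Connectivity inside a block is connectivity. -/
lemma conn_of_conn_blockCfg {j : E'} {ω : Config E} {x y : V}
    (h : Conn ends (blockCfg blk j ω) x y) : Conn ends ω x y :=
  conn_mono (blockCfg_le blk j ω) h

/-- An open block connects its terminals. -/
lemma conn_terminals_of_bsOpen {ω : Config E} {j : E'} {x y : V'}
    (h : bsOpen ends ends' q blk ω j = true) (hj : ends' j = s(x, y)) :
    Conn ends ω (q x) (q y) :=
  conn_of_conn_blockCfg ((bsOpen_eq_true_iff ends ends' q blk ω j).1 h x y hj)

/-- **From the pattern to the graph**: `k ↔ k'` in the skeleton under the pattern gives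
`q k ↔ q k'`. -/
lemma conn_of_conn_bsOpen {ω : Config E} {k k' : V'}
    (h : Conn ends' (bsOpen ends ends' q blk ω) k k') : Conn ends ω (q k) (q k') := by
  rw [Conn, SimpleGraph.reachable_iff_reflTransGen] at h
  induction h with
  | refl => exact conn_refl _ _ _
  | tail _ hxy ih =>
    refine conn_trans ih ?_
    rw [openGraph_adj] at hxy
    obtain ⟨_, j, hj, hends⟩ := hxy
    exact conn_terminals_of_bsOpen hj hends

/-- Two distinct terminals of a block connected inside it make the block open. -/
lemma bsOpen_of_conn_terminals {ω : Config E} {j : E'} {m m' : V'} (hm : m ∈ ends' j)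
    (hm' : m' ∈ ends' j) (hne : m ≠ m') (h : Conn ends (blockCfg blk j ω) (q m) (q m')) :
    bsOpen ends ends' q blk ω j = true := by
  rw [bsOpen_eq_true_iff]
  intro x y hxy
  have hj : ends' j = s(m, m') := (Sym2.mem_and_mem_iff hne).1 ⟨hm, hm'⟩
  rw [hj, Sym2.eq_iff] at hxy
  rcases hxy with ⟨rfl, rfl⟩ | ⟨rfl, rfl⟩
  · exact h
  · exact conn_symm h

omit [DecidableEq E'] in
/-- Two distinct terminals of a block are its skeleton edge. -/
lemma ends'_eq_of_mem {j : E'} {m m' : V'} (hm : m ∈ ends' j) (hm' : m' ∈ ends' j)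
    (hne : m ≠ m') : ends' j = s(m, m') :=
  (Sym2.mem_and_mem_iff hne).1 ⟨hm, hm'⟩

/-- **From the graph to the pattern**: `q k ↔ q k'` gives `k ↔ k'` in the skeleton under the
pattern (the cut argument: the terminals of the skeleton cluster of `k` together with everything
reached from them inside their own blocks form a set closed under open adjacency). -/
lemma conn_bsOpen_of_conn (hB : IsBlockSubst ends ends' q blk Vj) {ω : Config E} {k k' : V'}
    (h : Conn ends ω (q k) (q k')) : Conn ends' (bsOpen ends ends' q blk ω) k k' := by
  set σ := bsOpen ends ends' q blk ω with hσdef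
  -- the closed set
  set S : Set V := {v | ∃ m, Conn ends' σ k m ∧
    (v = q m ∨ ∃ j, m ∈ ends' j ∧ Conn ends (blockCfg blk j ω) (q m) v)} with hS
  have mem_S : ∀ {v : V} {m : V'} {j : E'}, Conn ends' σ k m → m ∈ ends' j →
      Conn ends (blockCfg blk j ω) (q m) v → v ∈ S :=
    fun hT hm hc => ⟨_, hT, Or.inr ⟨_, hm, hc⟩⟩
  -- a terminal of block `j` reached inside `j` from a terminal of `j` in the cluster is in the
  -- cluster
  have cluster_step : ∀ {m m' : V'} {j : E'}, Conn ends' σ k m → m ∈ ends' j → m' ∈ ends' j →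
      Conn ends (blockCfg blk j ω) (q m) (q m') → Conn ends' σ k m' := by
    intro m m' j hT hm hm' hc
    by_cases hmm : m = m'
    · exact hmm ▸ hT
    · exact conn_trans hT (conn_of_openAdj
        ⟨j, bsOpen_of_conn_terminals hm hm' hmm hc, ends'_eq_of_mem hm hm' hmm⟩)
  -- `S` is closed under open adjacency
  have hclosed : ∀ x ∈ S, ∀ y, (openGraph ends ω).Adj x y → y ∈ S := by
    intro x hx y hxy
    rw [openGraph_adj] at hxy
    obtain ⟨_, e, he, hends⟩ := hxy
    have hxj : x ∈ Vj (blk e) := hB.ends_mem e x (by rw [hends]; exact Sym2.mem_mk_left x y)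
    have hxy_j : Conn ends (blockCfg blk (blk e) ω) x y :=
      conn_of_openAdj ⟨e, blockCfg_apply_of_eq he rfl, hends⟩
    obtain ⟨m, hTm, hx⟩ := hx
    rcases hx with hxm | ⟨j, hmj, hc⟩
    · -- `x = q m`: the edge `e` lies in a block at `m`
      subst hxm
      exact mem_S hTm (hB.term_only _ _ hxj) hxy_j
    · by_cases hjj : j = blk e
      · subst hjj
        exact mem_S hTm hmj (conn_trans hc hxy_j)
      · -- `x` lies in two blocks: it is a terminal `q m'` of `j`, and `m'` is in the cluster
        have hxj₀ : x ∈ Vj j := mem_Vj_of_conn_blockCfg hB (hB.term_mem j m hmj) hc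
        obtain ⟨m', hm'j, hxm'⟩ := hB.inter_terms j (blk e) hjj x hxj₀ hxj
        subst hxm'
        exact mem_S (cluster_step hTm hmj hm'j hc) (hB.term_only _ _ hxj) hxy_j
  -- `q k ∈ S`
  have hk : q k ∈ S := ⟨k, conn_refl _ _ _, Or.inl rfl⟩
  -- `q k' ∈ S` forces `k'` into the cluster
  have hk' : q k' ∈ S := mem_of_conn_of_closed hclosed hk h
  obtain ⟨m, hTm, hx⟩ := hk'
  rcases hx with hqq | ⟨j, hmj, hc⟩
  · rw [hB.q_inj hqq]
    exact hTm
  · have hk'j : q k' ∈ Vj j := mem_Vj_of_conn_blockCfg hB (hB.term_mem j m hmj) hc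
    exact cluster_step hTm hmj (hB.term_only j k' hk'j) hc

/-- **Connectivity between the terminals of a block substitution is connectivity of its pattern
on the skeleton.** -/
theorem conn_marks_iff_bs (hB : IsBlockSubst ends ends' q blk Vj) (ω : Config E) (k k' : V') :
    Conn ends ω (q k) (q k') ↔ Conn ends' (bsOpen ends ends' q blk ω) k k' :=
  ⟨conn_bsOpen_of_conn hB, conn_of_conn_bsOpen⟩

end Conn

end BlockSubst

end Summit.Ventures.PercRepro2
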